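import Literature.MathematicalPhysics.QuantumFieldTheory.Balaban1983to89.B9Thm313WholeGGBlocksRegular

/-!
# `Balaban1983to89.B9Thm313WholeGGBlocksRegularT` — T. Bałaban, *Propagators for lattice gauge theories in a background field*, Commun. Math. Phys. **99** (1985) 389–434
# [`Balaban1985BackgroundPropagators`], Theorem 3.13 p. 426 over the REGULAR STATE of Theorem 3.12 pp. 421–423: THE ROW-21 S-LEAF's PER-MEMBER RESIDUAL
# (`B9Thm313WholeGGBlocksRegular.GG_inputs_of_stateS ∕ GG_blocks_of_stateS`) WITH THE (3.152)–(3.153) INPUT LETTERS TAKEN FIELD-WISE — the three families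
# `rgdd` (RD\*G₁∇\*_μ : bHX ε → bHW ε), `dgDvd` (∇_νG₀D : bHW ε → 𝔠), `pdgDvd` (Φ^X_β∇_νG₀D) — INSTEAD OF the record `Letters313IMBC`, whose right-form field
# `tDv` ((Δ′_π+Δ⁽²⁾_π)∘G₀∇_U INTO 𝔠⁽¹⁾) the S chain never reads; everything else VERBATIM

[4] = T. Bałaban, *Propagators and renormalization transformations for lattice gauge theories. II*, Commun. Math. Phys. **96** (1984) 223–250 [`Balaban1984PropagatorsII`].
statement-level skeleton of published theorems with citation tags; proofs where landed; nothing here is a claim about the Yang–Mills mass gap.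

THE PRINT.  Thm 3.13 p. 426 (𝔊 satisfies (3.42)–(3.47) by (3.152)–(3.153), Theorem 3.12 and the estimates for G′, R); Thm 3.12 pp. 421–423: the perturbation
Δ′_π + Δ⁽²⁾_π is applied to REGULAR functions only (p. 423), the induction running *"in all norms (3.42)–(3.47)"* (p. 422).

WHY THIS FILE (cell `pub-ymgap`, node N06, bundle F7 rows 20–21, seat dag-n06-l g29; programme P-U8S″ under director-ym №289 (1): «U8 cured» = NO raw-class step
letter — and no right form T∘G₀∘F — anywhere in the certificate's cone).  LOCATED-U8″ (this seat, 2026-08-29; dag-n06-d g18 HDR106 «OBSERVATION» independently):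
the landed residual `GG_blocks_of_stateS` (p713611) takes `hLIM : Letters313IMBC …`, a record whose field `tDv : (Δ′_π+Δ⁽²⁾_π) ∘ (G₀∇_U) : bHW ε → 𝔠⁽¹⁾` is the
RIGHT FORM of LOCATED-U8′ §1 (T's leading ∇_U un-absorbed on the output side) — but `GG_inputs_of_stateS` reads ONLY `.rgdd ∕ .dgDvd ∕ .pdgDvd` (tree lines 531, 581,
612, 630), never `.tDv ∕ .vanishX ∕ .leX`.  So the record is a dead passenger that forces the certificate to DISPLAY `tDv`.  THIS FILE re-types the two theorems
with the three read families as hypotheses: ★★ `GG_inputs_of_stateST`, ★★★ `GG_blocks_of_stateST` (proofs = p713611's bodies with `hLIM.rgdd ↦ hrgdd`,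
`hLIM.dgDvd ↦ hdgDvd`, `hLIM.pdgDvd ↦ hpdgDvd`; `GG_entries_of_stateS ∕ GG_probes_of_stateS` are CITED by name, not restated); the row-21 S-leaf twin
`B9Thm313WholeLeafCompletePairMBCZcUST` calls them, and the knit's display `hLIM` shrinks to three θv-free families (dag-n06-d INTENT-13 already displays
`hdgDvd` so).  Conclusions IDENTICAL to p713611's.
HONEST SCOPE.  Re-typing of landed pieces; every analytic member is a HYPOTHESIS of printed species; nothing of [B9]∕[4] asserted; no pin, no certificate edit;
COUNT-NEUTRAL; N06 NOT discharged; nothing continuum ∕ OS positivity ∕ mass gap ∕ Clay.  Cell `pub-ymgap` (HUMAN RULING D-0062), Track A node N06 [B9],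
seat `pub-ymgap-dag-n06-l` (g29), 2026-08-29.  NEW file; nothing landed is modified.
-/

namespace Literature.MathematicalPhysics.QuantumFieldTheory.Balaban1983to89.B9Thm313WholeGGBlocksRegularT

open Literature.MathematicalPhysics.QuantumFieldTheory.Balaban1983to89
open Finset B6RandomWalk B6RandomWalkHom B9Thm34Ext B9Thm37GlueCor36 B11SectG B9SectDSup B9SectDL2Decay
open B9Thm37AllNorms B9Thm37AllNormsInstances B9FromB6 B9FromB6ModelSignsOn B9SectBStepWhole B9Thm312Whole B9Thm312WholeLeaf B9Thm312WholeLeft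
open B9Thm313Whole B9Thm313WholeLeft B9RWSums343Holder B9RWSumsReadsRel B9RWSumsReadsNbr B9Ineq347 B9Thm312WholeClasses B9Thm312WholeL2
open B9Thm312WholeBlocksRel B9Thm312WholeBlocksNbr B9Thm312WholeHolder B9Thm312WholeHHolder B9Thm313WholeHolder B9Thm313WholeL2G B9Thm313WholeL2GP
open B9Thm313WholeInput B9Thm313WholeBlocksNbr B9RWSums346SecondDiff B9Thm313WholeBlocksNbrRec B9RWSums344InputFam B9Thm312WholeDir
open B9Thm312WholeBlocksPairM B9Thm313WholeDir B9Thm313WholeDirInput B9Thm313WholeBlocksPairM B9Thm312WholeDirB B9Thm313WholeDirInputB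
open B9Thm313WholeBlocksPairMB B9Thm313WholeZ B9Thm313WholeLeftZ B9Thm313WholeHolderZ B9Thm313WholeInputZ B9Thm313WholeDirZ B9Thm313WholeDirInputZ
open B9Thm313WholeDirInputBZ B9Thm313WholeL2GZ B9Thm313WholeL2GPZ B9Thm313WholeDirL2Z B9Thm313WholeBlocksPairMZ B9Thm313WholeBlocksPairMBZ
open B9Thm313WholeInputC B9Thm313WholeDirInputBC B9Thm313WholeBlocksPairMBCZ B9Thm313WholeRgdFrom3152 B9Thm313WholeLettersCut B9Thm313WholeCutCores
open B9Thm313WholeBlocksPairMZCut B9Thm313WholeDirInputBCZCut B9Thm312WholeHZ B9Thm312WholeStepDirFrom3131 B9Thm37Glue B9Thm312WholeBlocksNbrRec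
open B9Thm313WholeSupReadersCut B9Thm313WholeL2MixedCut
open B9Thm312WholeStepRegular B9Thm312WholeMembersRegular B9Thm313WholeGGEntriesMembers B9Thm313WholeGGProbesMembers B9Thm313WholeGGInputsMembers
open B9Thm313WholeGGBlocksEntries B9Thm313WholeGGBlocksRegular

noncomputable section

section OneMember

variable {g : B9.Geometry} {B : B9.Backgrounds} {X Y Z W PX PY P : Type}
variable [Fintype X] [Fintype Y] [Fintype Z] [Fintype W] [Fintype PX] [Fintype PY] [Fintype P] [Fintype g.Site] [DecidableEq g.Site]
variable {R₀ : ℝ} {H₀ : Prop}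

/-! ## §1 The (3.44) ∕ (3.45) input lines of 𝔊 from the state — the input letters taken FIELD-WISE (no `tDv`) -/

omit [Fintype PY] [DecidableEq g.Site] in
/-- ★★ **THE (3.44) ∕ (3.45) INPUT LINES OF 𝔊 ON THE PAIR FAMILY FROM THE REGULAR STATE** (one member, one configuration): per pair, the pieces ∇_{q.1}G₁∇\*_{q.2} (out of
`bHX ε`, Theorem 3.3's `h44m ∕ h45m`), ∇_νG₁D (out of `bHW ε`, the DISPLAYED FAMILIES `hdgDvd ∕ hpdgDvd` — no `Letters313IMBC` record, hence no `tDv`), ∇_νG₁Q\* (out of Z_w by `dgQsd ∕ pQd`, transferred to Z_{len·w} by the scale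
transfer `hST1`) by the first resolvent form from the state fields ∇_{U,ν}G₀T, Φ^X_β∇_{U,ν}G₀T (out of 𝔖₁, resp. 𝔖₂ for the Z-pieces) and the right entries G₁∇\*_μ, G₁D, G₁Q\* INTO
the states; the right entry `G₁∇\*_μ : bHX ε → 𝔠⁽¹⁾` by the sup reading; then `GG_input44∕45Family_of_members`; brought to ANY `K₄₄ ε`, `K₄₅ ε β` above the displayed
polynomials and to the rate ρ₄ (ρ₄ + 3σ ≤ (1−α)ρ′).
[cite: Balaban1985BackgroundPropagators, Thm 3.13 p.426 + Thm 3.12 p.423 + (3.44)–(3.45) p.398 + (3.152)–(3.153) p.426; Balaban1984PropagatorsII, (2.52) p.232 + Lemma 2.1 (2.60)–(2.61) p.234] -/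
theorem GG_inputs_of_stateST (hG : GeoOK g) (𝔭 : HolderProbes g B X Y PX PY) {𝔬 : Ops g B X Y Z W} {U : B.Cfg} {Dd Dds : B.Cfg → P → Module.End ℝ (X → ℝ)}
    {bHX : ℝ → BlockNorm (toB6 g R₀ H₀) (X → ℝ)} {bHW : ℝ → BlockNorm (toB6 g R₀ H₀) (W → ℝ)} {bH : BlockNorm (toB6 g R₀ H₀) (W → ℝ)}
    {Gp : B.Cfg → Module.End ℝ (W → ℝ)} {bXH : BlockNorm (toB6 g R₀ H₀) (X → ℝ)} (𝔖₂ 𝔖₁ : BlockNorm (toB6 g R₀ H₀) (X → ℝ))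
    {tD tR B₀ B₃ CR₁ κS Λ₁ δ₀ δ₃ δK δP ρ ρ₁ ρ' ρ₄ α σ c : ℝ} {tH tI tV Br Bh Bi Bq Bd K44 : ℝ → ℝ}
    {Bi2 Bd2 K45 : ℝ → ℝ → ℝ} (hrow : RowSum (toB6 g R₀ H₀) σ c) (hc : 0 ≤ c) (htD : 0 ≤ tD) (htR : 0 ≤ tR) (htH : ∀ β, 0 ≤ β → β < 1 → 0 ≤ tH β)
    (htI : ∀ ε, 0 < ε → 0 ≤ tI ε) (htV : ∀ ε, 0 < ε → 0 ≤ tV ε) (hB₃ : 0 ≤ B₃) (hCR₁ : 0 ≤ CR₁) (hκS : 1 ≤ κS) (hBr : ∀ ε, 0 < ε → 0 ≤ Br ε)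
    (hBi : ∀ ε, 0 < ε → ε ≤ 1 → 0 ≤ Bi ε) (hBq : ∀ β, 0 ≤ β → β < 1 → 0 ≤ Bq β) (hBd : ∀ ε, 0 < ε → ε ≤ 1 → 0 ≤ Bd ε)
    (hBi2 : ∀ ε β, 0 < ε → ε ≤ 1 → 0 ≤ β → β < 1 → 0 ≤ Bi2 ε β) (hBd2 : ∀ ε β, 0 < ε → ε ≤ 1 → 0 ≤ β → β < 1 → 0 ≤ Bd2 ε β)
    (hκW : ∀ ε, (bHW ε).κ ≤ κS) (hκ2 : 𝔖₂.κ ≤ κS) (hκ1 : 𝔖₁.κ ≤ κS) (hα0 : 0 ≤ α) (hσ : 0 ≤ σ) (hρ' : 0 < ρ') (hρ'ρ : ρ' + 3 * σ ≤ ρ) (hρ₄0 : 0 ≤ ρ₄)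
    (hρ₄r : ρ₄ + 3 * σ ≤ (1 - α) * ρ') (hρS : ρ ≤ δ₀) (hρ₃ : ρ ≤ δ₃) (hρ₁ : ρ₁ = ρ + σ) (hρP : ρ + 2 * σ ≤ δP) (hρK : ρ + 2 * σ ≤ δK)
    (hST1 : ScaleTransfer g ρ' α Λ₁ (fun y => g.len y ^ (1 : ℝ))) (hΛ₁0 : 0 ≤ Λ₁)
    (hK44le : ∀ ε, 0 < ε → ε ≤ 1 → (Bi ε + κS * tD * tI ε * c) + κS * (Bd ε + κS * tD * tV ε * c) * Br ε * c +
      (B₃ + κS * tD * tR * c) * Λ₁ * (B₃ * (B₃ * (κS * CR₁ * tI ε * c) * c) * c) * c ≤ K44 ε)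
    (hK45le : ∀ ε β, 0 < ε → ε ≤ 1 → 0 ≤ β → β < 1 → (Bi2 ε β + κS * tH β * tI (β + ε) * c) +
      κS * (Bd2 ε β + κS * tH β * tV (β + ε) * c) * Br (β + ε) * c +
      (Bq β + κS * tH β * tR * c) * Λ₁ * (B₃ * (B₃ * (κS * CR₁ * tI (β + ε) * c) * c) * c) * c ≤ K45 ε β)
    (hH0 : Thm33G0Dir 𝔬 𝔭 Dd Dds R₀ H₀ bHX B₀ Bh Bi Bi2 δ₀ U) {wZ : g.Site → ℝ} {hwZ : ∀ y, 0 < wZ y}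
    (hL : Letters313Zc 𝔬 Gp R₀ H₀ hG wZ hwZ B₃ δ₃ bXH U) (hLDM : Letters313DMZ 𝔬 𝔭 Dd R₀ H₀ hG wZ hwZ B₃ Bq δ₃ bH U)
    (hrgdd : ∀ (μ : P) (ε : ℝ), 0 < ε → HasMaj (bHX ε) (bHW ε) (𝔬.R U ∘ₗ 𝔬.Dvstar U ∘ₗ 𝔬.G1 U ∘ₗ Dds U μ)
      (fun a b => Br ε * Real.exp (-(δ₃ * g.dist a b))))
    (hdgDvd : ∀ (ν : P) (ε : ℝ), 0 < ε → ε ≤ 1 → HasMaj (bHW ε) (BlockNorm.ofBlocks (toB6 g R₀ H₀) 𝔬.blk)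
      (Dd U ν ∘ₗ (𝔬.G0 U ∘ₗ 𝔬.Dv U)) (fun (a b : g.Site) => Bd ε * Real.exp (-(δ₃ * g.dist a b))))
    (hpdgDvd : ∀ (ν : P) (ε β : ℝ), 0 < ε → ε ≤ 1 → 0 ≤ β → β < 1 → HasMaj (bHW (β + ε)) (BlockNorm.ofBlocks (toB6 g R₀ H₀) 𝔭.blkPX)
      ((𝔭.ΦX U β ∘ₗ Dd U ν) ∘ₗ (𝔬.G0 U ∘ₗ 𝔬.Dv U))
      (fun (a b : g.Site) => Bd2 ε β * g.len a ^ (-β) * Real.exp (-(δ₃ * g.dist a b)))) (hI : Identities 𝔬 U)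
    (hDd2 : ∀ ν : P, HasMaj 𝔖₂ (cNorm R₀ H₀ 𝔬.blk hG.lenle 1) (Dd U ν ∘ₗ 𝔬.G0 U ∘ₗ (𝔬.Tpi U + 𝔬.T2 U))
      (fun a b => tD * Real.exp (-(δK * g.dist a b))))
    (hXd2 : ∀ (ν : P) (β : ℝ), 0 ≤ β → β < 1 → HasMaj 𝔖₂ (cNormR R₀ H₀ 𝔭.blkPX hG.lenle (β - 1))
      ((𝔭.ΦX U β ∘ₗ Dd U ν ∘ₗ 𝔬.G0 U) ∘ₗ (𝔬.Tpi U + 𝔬.T2 U)) (fun a b => tH β * Real.exp (-(δK * g.dist a b))))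
    (hDd1 : ∀ ν : P, HasMaj 𝔖₁ (cNormR R₀ H₀ 𝔬.blk hG.lenle 0) (Dd U ν ∘ₗ 𝔬.G0 U ∘ₗ (𝔬.Tpi U + 𝔬.T2 U))
      (fun a b => tD * Real.exp (-(δK * g.dist a b))))
    (hXd1 : ∀ (ν : P) (β : ℝ), 0 ≤ β → β < 1 → HasMaj 𝔖₁ (cNormR R₀ H₀ 𝔭.blkPX hG.lenle β)
      ((𝔭.ΦX U β ∘ₗ Dd U ν ∘ₗ 𝔬.G0 U) ∘ₗ (𝔬.Tpi U + 𝔬.T2 U)) (fun a b => tH β * Real.exp (-(δK * g.dist a b))))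
    (hGQ2 : HasMaj (weightNorm (BlockNorm.ofBlocks (toB6 g R₀ H₀) 𝔬.blkZ) wZ fun y => (hwZ y).le) 𝔖₂ (𝔬.G1 U ∘ₗ 𝔬.Qstar U)
      (fun a b => tR * Real.exp (-(ρ₁ * g.dist a b))))
    (hGI1 : ∀ (μ : P) (ε : ℝ), 0 < ε → HasMaj (bHX ε) 𝔖₁ (𝔬.G1 U ∘ₗ Dds U μ) (fun a b => tI ε * Real.exp (-(ρ₁ * g.dist a b))))
    (hGV1 : ∀ ε : ℝ, 0 < ε → HasMaj (bHW ε) 𝔖₁ (𝔬.G1 U ∘ₗ 𝔬.Dv U) (fun a b => tV ε * Real.exp (-(ρ₁ * g.dist a b))))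
    (hRd1 : HasMaj 𝔖₁ (cNormR R₀ H₀ 𝔬.blk hG.lenle (-1)) LinearMap.id (fun a b => CR₁ * Real.exp (-(δP * g.dist a b)))) :
    (∀ ε, 0 < ε → ε ≤ 1 → HasMaj (bHX ε) (BlockNorm.ofBlocks (toB6 g R₀ H₀) (𝔬.blk ∘ Prod.fst))
      (familyOp (fun q : P × P => Dd U q.1 ∘ₗ (𝔬.GG U ∘ₗ Dds U q.2))) (fun (a b : g.Site) => K44 ε * Real.exp (-(ρ₄ * g.dist a b)))) ∧
    (∀ ε β, 0 < ε → ε ≤ 1 → 0 ≤ β → β < 1 →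
      HasMaj (bHX (β + ε)) (BlockNorm.ofBlocks (toB6 g R₀ H₀) (𝔭.blkPX ∘ Prod.fst))
      (sliceProbe (𝔭.ΦX U β) ∘ₗ familyOp (fun q : P × P => Dd U q.1 ∘ₗ (𝔬.GG U ∘ₗ Dds U q.2)))
      (fun (a b : g.Site) => K45 ε β * g.len a ^ (-β) * Real.exp (-(ρ₄ * g.dist a b)))) := by
  set A₁ : ℝ := κS * CR₁ * tR * c with hA₁def
  have htri : Triangle254 (toB6 g R₀ H₀) := fun a b c => hG.tri a b c
  have hfix1 := fix_of_inverses hI.invG0' hI.invG1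
  have hlen := hG.lenle
  have hκS0 : 0 ≤ κS := zero_le_one.trans hκS
  -- rates
  have hρ0 : 0 ≤ ρ := by linarith
  have hρ₁0 : 0 ≤ ρ₁ := by rw [hρ₁]; linarith
  have hρρ₁ : ρ ≤ ρ₁ := by rw [hρ₁]; linarith
  have hρ₁K : ρ₁ + σ ≤ δK := by rw [hρ₁]; linarith
  have hρP' : ρ + σ ≤ δP := by linarith
  have hρK' : ρ + σ ≤ δK := by linarith
  have hρ'0 : 0 ≤ ρ' := hρ'.le
  have hρ'σ0 : 0 ≤ ρ' + σ := by linarith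
  have hρ'σ₁ : ρ' + σ ≤ ρ₁ := by rw [hρ₁]; linarith
  have hρ'σK : ρ' + σ + σ ≤ δK := by linarith
  have hρ'₃ : ρ' ≤ δ₃ := by linarith
  have hρ'σ₃ : ρ' + σ ≤ δ₃ := by linarith
  have hρ'₁ : ρ' ≤ ρ₁ := by linarith
  have hρ'K : ρ' + σ ≤ δK := by linarith
  have hρm0 : 0 ≤ ρ - σ := by linarith
  have hρm₀ : ρ - σ ≤ δ₀ := by linarith
  have hρm₃ : ρ - σ ≤ δ₃ := by linarith
  have hρm₁ : ρ - σ ≤ ρ₁ := by linarith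
  have hρmK : ρ - σ + σ ≤ δK := by linarith
  set ρ₂ : ℝ := ρ₄ + 2 * σ with hρ₂def
  have hρ₂0 : 0 ≤ ρ₂ := by rw [hρ₂def]; linarith
  have h1α : (1 - α) * ρ' ≤ ρ' := by nlinarith
  have hρ₂α : ρ₂ ≤ (1 - α) * ρ' := by rw [hρ₂def]; linarith
  have hρ₂m : ρ₂ ≤ ρ - σ := by linarith
  have hρ₂ρ : ρ₂ ≤ ρ := by linarith
  have hρ₂₃ : ρ₂ + σ ≤ δ₃ := by linarith
  -- the cutting costs of the middle classes below κ_S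
  have hk2 : ∀ {a : ℝ}, 0 ≤ a → 𝔖₂.κ * a ≤ κS * a := fun ha => mul_le_mul_of_nonneg_right hκ2 ha
  have hk1 : ∀ {a : ℝ}, 0 ≤ a → 𝔖₁.κ * a ≤ κS * a := fun ha => mul_le_mul_of_nonneg_right hκ1 ha
  have hkk2 : ∀ {a : ℝ}, 0 ≤ a → 𝔖₂.κ * a * c ≤ κS * a * c := fun ha => mul_le_mul_of_nonneg_right (hk2 ha) hc
  have hkk1 : ∀ {a : ℝ}, 0 ≤ a → 𝔖₁.κ * a * c ≤ κS * a * c := fun ha => mul_le_mul_of_nonneg_right (hk1 ha) hc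
  have hA₁0 : 0 ≤ A₁ := mul_nonneg (mul_nonneg (mul_nonneg hκS0 hCR₁) htR) hc
  have hTD0 : 0 ≤ κS * tD * tR * c := mul_nonneg (mul_nonneg (mul_nonneg hκS0 htD) htR) hc
  -- kernel weakening helper
  have wk : ∀ {F₁ F₂ : Type} [AddCommGroup F₁] [Module ℝ F₁] [AddCommGroup F₂] [Module ℝ F₂]
      {b₁ : BlockNorm (toB6 g R₀ H₀) F₁} {b₂ : BlockNorm (toB6 g R₀ H₀) F₂} {T : F₁ →ₗ[ℝ] F₂} {C C' r₁ : ℝ},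
      C ≤ C' → HasMaj b₁ b₂ T (fun a b => C * Real.exp (-(r₁ * g.dist a b))) → HasMaj b₁ b₂ T (fun a b => C' * Real.exp (-(r₁ * g.dist a b))) :=
    fun hCC h => h.mono fun a b => mul_le_mul_of_nonneg_right hCC (Real.exp_nonneg _)
  have hRd1n : HasMaj 𝔖₁ (cNorm R₀ H₀ 𝔬.blk hG.lenle 1) LinearMap.id (fun a b => CR₁ * Real.exp (-(δP * g.dist a b))) := by
    intro y' μ hμ y
    have hb := hRd1 y' μ hμ y
    rwa [show (-1 : ℝ) = -((1 : ℕ) : ℝ) by norm_num, cNormR_loc_neg_natCast hG] at hb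
  -- (1) the right entry G₁∇*_μ read in the sup class
  have h2A : ∀ (μ : P) (ε : ℝ), 0 < ε → HasMaj (bHX ε) (cNorm R₀ H₀ 𝔬.blk hG.lenle 1) (𝔬.G1 U ∘ₗ Dds U μ)
      (fun a b => κS * CR₁ * tI ε * c * Real.exp (-(ρ * g.dist a b))) := by
    intro μ ε hε
    have h := hasMaj_read_of_state hG hrow (htI ε hε) hCR₁ hρ0 hρρ₁ hρP' (hGI1 μ ε hε) hRd1n
    rw [LinearMap.id_comp] at h
    exact wk (by rw [mul_assoc 𝔖₁.κ, mul_assoc 𝔖₁.κ, mul_assoc κS, mul_assoc κS]; exact hk1 (by have := htI ε hε; positivity)) h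
  -- (3) the (3.44) pieces per pair, at the rate ρ₂ = ρ₄ + 2σ
  have hGop : ∀ (q : P × P) (ε : ℝ), 0 < ε → ε ≤ 1 → HasMaj (bHX ε) (BlockNorm.ofBlocks (toB6 g R₀ H₀) 𝔬.blk)
      (Dd U q.1 ∘ₗ (𝔬.G1 U ∘ₗ Dds U q.2)) (fun a b => (Bi ε + κS * tD * tI ε * c) * Real.exp (-(ρ₂ * g.dist a b))) := by
    intro q ε hε0 hε1
    have h := input44_of_stateS hG hrow htD (hBi ε hε0 hε1) (htI ε hε0) hρm0 hρm₀ hρm₁ hρmK (hH0.h44m q ε hε0 hε1) (hDd1 q.1)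
      (hGI1 q.2 ε hε0) hfix1
    exact (wk (by linarith only [hkk1 (mul_nonneg htD (htI ε hε0))]) h).of_rate_le hG.dnn
      (by have := hBi ε hε0 hε1; have := htI ε hε0; positivity) hρ₂m
  have hGDv : ∀ (ν : P) (ε : ℝ), 0 < ε → ε ≤ 1 → HasMaj (bHW ε) (BlockNorm.ofBlocks (toB6 g R₀ H₀) 𝔬.blk)
      (Dd U ν ∘ₗ (𝔬.G1 U ∘ₗ 𝔬.Dv U)) (fun a b => (Bd ε + κS * tD * tV ε * c) * Real.exp (-(ρ₂ * g.dist a b))) := by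
    intro ν ε hε0 hε1
    have h44' : HasMaj (bHW ε) (cNormR R₀ H₀ 𝔬.blk hG.lenle 0) (Dd U ν ∘ₗ 𝔬.G0 U ∘ₗ 𝔬.Dv U)
        (fun (a b : g.Site) => Bd ε * Real.exp (-(δ₃ * g.dist a b))) := by
      intro y' μ hμ y
      rw [cNormR_loc, Real.rpow_zero, one_mul]
      exact (hdgDvd ν ε hε0 hε1) y' μ hμ y
    have h := hasMaj_left_rightS hG hrow htD (hBd ε hε0 hε1) (htV ε hε0) hρm0 hρm₃ hρm₁ hρmK (hDd1 ν) h44' (hGV1 ε hε0) hfix1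
    have h' : HasMaj (bHW ε) (BlockNorm.ofBlocks (toB6 g R₀ H₀) 𝔬.blk) (Dd U ν ∘ₗ (𝔬.G1 U ∘ₗ 𝔬.Dv U))
        (fun a b => (Bd ε + 𝔖₁.κ * tD * tV ε * c) * Real.exp (-((ρ - σ) * g.dist a b))) := (hasMaj_of_out_zero h).congr fun μ => rfl
    exact (wk (by linarith only [hkk1 (mul_nonneg htD (htV ε hε0))]) h').of_rate_le hG.dnn
      (by have := hBd ε hε0 hε1; have := htV ε hε0; positivity) hρ₂m
  have hKQ0 : 0 ≤ B₃ + κS * tD * tR * c := add_nonneg hB₃ hTD0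
  have hGQ44 : ∀ ν : P,
      HasMaj (weightNorm (BlockNorm.ofBlocks (toB6 g R₀ H₀) 𝔬.blkZ) (fun y => g.len y * wZ y) fun y => (wZlen_pos hG hwZ y).le)
      (BlockNorm.ofBlocks (toB6 g R₀ H₀) 𝔬.blk) (Dd U ν ∘ₗ 𝔬.G1 U ∘ₗ 𝔬.Qstar U)
      (fun a b => (B₃ + κS * tD * tR * c) * Λ₁ * Real.exp (-(ρ₂ * g.dist a b))) := by
    intro ν
    have hDQ : HasMaj (weightNorm (BlockNorm.ofBlocks (toB6 g R₀ H₀) 𝔬.blkZ) wZ fun y => (hwZ y).le) (cNorm R₀ H₀ 𝔬.blk hG.lenle 1)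
        (Dd U ν ∘ₗ 𝔬.G1 U ∘ₗ 𝔬.Qstar U) (fun y y' => (B₃ + κS * tD * tR * c) * Real.exp (-(ρ' * g.dist y y'))) := by
      have h := hasMaj_left_rightS hG hrow htD hB₃ htR hρ'0 hρ'₃ hρ'₁ hρ'K (hDd2 ν) (hLDM.dgQsd ν) hGQ2 hfix1
      exact wk (by linarith only [hkk2 (mul_nonneg htD htR)]) h
    have hDQR : HasMaj (weightNorm (BlockNorm.ofBlocks (toB6 g R₀ H₀) 𝔬.blkZ) wZ fun y => (hwZ y).le) (cNormR R₀ H₀ 𝔬.blk hG.lenle (-1))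
        (Dd U ν ∘ₗ 𝔬.G1 U ∘ₗ 𝔬.Qstar U) (fun y y' => (B₃ + κS * tD * tR * c) * Real.exp (-(ρ' * g.dist y y'))) := by
      have h := hasMaj_toR_tgt hG hDQ
      simp only [Nat.cast_one] at h
      exact h
    have hDQT := hasMaj_transfer_weight hG (fun y => (hwZ y).le) hKQ0 hST1 hDQR
    have e2 : (-1 : ℝ) + 1 = 0 := by ring
    rw [e2] at hDQT
    exact hasMaj_of_out_zero (hDQT.of_rate_le hG.dnn (mul_nonneg hKQ0 hΛ₁0) hρ₂α)
  -- the (3.45) pieces per pair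
  have hGop45 : ∀ (q : P × P) (ε β : ℝ), 0 < ε → ε ≤ 1 → 0 ≤ β → β < 1 →
      HasMaj (bHX (β + ε)) (cNormR R₀ H₀ 𝔭.blkPX hG.lenle β) ((𝔭.ΦX U β ∘ₗ Dd U q.1) ∘ₗ (𝔬.G1 U ∘ₗ Dds U q.2))
      (fun a b => (Bi2 ε β + κS * tH β * tI (β + ε) * c) * Real.exp (-(ρ₂ * g.dist a b))) := by
    intro q ε β hε0 hε1 hb0 hb1
    have hε' : 0 < β + ε := by linarith
    have hP : HasMaj 𝔖₁ (cNormR R₀ H₀ 𝔭.blkPX hG.lenle β) ((𝔭.ΦX U β ∘ₗ Dd U q.1) ∘ₗ 𝔬.G0 U ∘ₗ (𝔬.Tpi U + 𝔬.T2 U))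
        (fun a b => tH β * Real.exp (-(δK * g.dist a b))) := (hXd1 q.1 β hb0 hb1).congr fun μ => rfl
    have h45' : HasMaj (bHX (β + ε)) (BlockNorm.ofBlocks (toB6 g R₀ H₀) 𝔭.blkPX) ((𝔭.ΦX U β ∘ₗ Dd U q.1) ∘ₗ (𝔬.G0 U ∘ₗ Dds U q.2))
        (fun (a b : g.Site) => Bi2 ε β * g.len a ^ (-β) * Real.exp (-(δ₀ * g.dist a b))) := (hH0.h45m q ε β hε0 hε1 hb0 hb1).congr fun μ => rfl
    have h := input45_of_stateS hG hrow (htH β hb0 hb1) (hBi2 ε β hε0 hε1 hb0 hb1) (htI (β + ε) hε') hρm0 hρm₀ hρm₁ hρmK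
      h45' hP (hGI1 q.2 (β + ε) hε') hfix1
    have h' : HasMaj (bHX (β + ε)) (cNormR R₀ H₀ 𝔭.blkPX hG.lenle β) ((𝔭.ΦX U β ∘ₗ Dd U q.1) ∘ₗ (𝔬.G1 U ∘ₗ Dds U q.2))
        (fun a b => (Bi2 ε β + 𝔖₁.κ * tH β * tI (β + ε) * c) * Real.exp (-((ρ - σ) * g.dist a b))) :=
      hasMaj_weight_out hG (h.mono fun a b => le_of_eq (by ring))
    exact (wk (by linarith only [hkk1 (mul_nonneg (htH β hb0 hb1) (htI (β + ε) hε'))]) h').of_rate_le hG.dnn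
      (by have := hBi2 ε β hε0 hε1 hb0 hb1; have := htH β hb0 hb1; have := htI (β + ε) hε'; positivity) hρ₂m
  have hGD45 : ∀ (ν : P) (ε β : ℝ), 0 < ε → ε ≤ 1 → 0 ≤ β → β < 1 →
      HasMaj (bHW (β + ε)) (cNormR R₀ H₀ 𝔭.blkPX hG.lenle β) ((𝔭.ΦX U β ∘ₗ Dd U ν) ∘ₗ (𝔬.G1 U ∘ₗ 𝔬.Dv U))
      (fun a b => (Bd2 ε β + κS * tH β * tV (β + ε) * c) * Real.exp (-(ρ₂ * g.dist a b))) := by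
    intro ν ε β hε0 hε1 hb0 hb1
    have hε' : 0 < β + ε := by linarith
    have hP : HasMaj 𝔖₁ (cNormR R₀ H₀ 𝔭.blkPX hG.lenle β) ((𝔭.ΦX U β ∘ₗ Dd U ν) ∘ₗ 𝔬.G0 U ∘ₗ (𝔬.Tpi U + 𝔬.T2 U))
        (fun a b => tH β * Real.exp (-(δK * g.dist a b))) := (hXd1 ν β hb0 hb1).congr fun μ => rfl
    have h := input45_of_stateS hG hrow (htH β hb0 hb1) (hBd2 ε β hε0 hε1 hb0 hb1) (htV (β + ε) hε') hρm0 hρm₃ hρm₁ hρmK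
      (hpdgDvd ν ε β hε0 hε1 hb0 hb1) hP (hGV1 (β + ε) hε') hfix1
    have h' : HasMaj (bHW (β + ε)) (cNormR R₀ H₀ 𝔭.blkPX hG.lenle β) ((𝔭.ΦX U β ∘ₗ Dd U ν) ∘ₗ (𝔬.G1 U ∘ₗ 𝔬.Dv U))
        (fun a b => (Bd2 ε β + 𝔖₁.κ * tH β * tV (β + ε) * c) * Real.exp (-((ρ - σ) * g.dist a b))) :=
      hasMaj_weight_out hG (h.mono fun a b => le_of_eq (by ring))
    exact (wk (by linarith only [hkk1 (mul_nonneg (htH β hb0 hb1) (htV (β + ε) hε'))]) h').of_rate_le hG.dnn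
      (by have := hBd2 ε β hε0 hε1 hb0 hb1; have := htH β hb0 hb1; have := htV (β + ε) hε'; positivity) hρ₂m
  have hGQ45 : ∀ (ν : P) (β : ℝ), 0 ≤ β → β < 1 →
      HasMaj (weightNorm (BlockNorm.ofBlocks (toB6 g R₀ H₀) 𝔬.blkZ) (fun y => g.len y * wZ y) fun y => (wZlen_pos hG hwZ y).le)
      (cNormR R₀ H₀ 𝔭.blkPX hG.lenle β) ((𝔭.ΦX U β ∘ₗ Dd U ν) ∘ₗ 𝔬.G1 U ∘ₗ 𝔬.Qstar U)
      (fun a b => (Bq β + κS * tH β * tR * c) * Λ₁ * Real.exp (-(ρ₂ * g.dist a b))) := by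
    intro ν β hb0 hb1
    have hKQ' : 0 ≤ Bq β + κS * tH β * tR * c := add_nonneg (hBq β hb0 hb1) (mul_nonneg (mul_nonneg (mul_nonneg hκS0 (htH β hb0 hb1)) htR) hc)
    have hP : HasMaj 𝔖₂ (cNormR R₀ H₀ 𝔭.blkPX hG.lenle (β - 1)) ((𝔭.ΦX U β ∘ₗ Dd U ν) ∘ₗ 𝔬.G0 U ∘ₗ (𝔬.Tpi U + 𝔬.T2 U))
        (fun a b => tH β * Real.exp (-(δK * g.dist a b))) := (hXd2 ν β hb0 hb1).congr fun μ => rfl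
    have hEF : HasMaj (weightNorm (BlockNorm.ofBlocks (toB6 g R₀ H₀) 𝔬.blkZ) wZ fun y => (hwZ y).le) (cNormR R₀ H₀ 𝔭.blkPX hG.lenle (β - 1))
        ((𝔭.ΦX U β ∘ₗ Dd U ν) ∘ₗ 𝔬.G0 U ∘ₗ 𝔬.Qstar U) (fun a b => Bq β * Real.exp (-(δ₃ * g.dist a b))) := (hLDM.pQd ν β hb0 hb1).congr fun μ => rfl
    have hDQ : HasMaj (weightNorm (BlockNorm.ofBlocks (toB6 g R₀ H₀) 𝔬.blkZ) wZ fun y => (hwZ y).le) (cNormR R₀ H₀ 𝔭.blkPX hG.lenle (β - 1))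
        ((𝔭.ΦX U β ∘ₗ Dd U ν) ∘ₗ 𝔬.G1 U ∘ₗ 𝔬.Qstar U) (fun y y' => (Bq β + κS * tH β * tR * c) * Real.exp (-(ρ' * g.dist y y'))) := by
      have h := hasMaj_left_rightS hG hrow (htH β hb0 hb1) (hBq β hb0 hb1) htR hρ'0 hρ'₃ hρ'₁ hρ'K hP hEF hGQ2 hfix1
      exact wk (by linarith only [hkk2 (mul_nonneg (htH β hb0 hb1) htR)]) h
    have hDQT := hasMaj_transfer_weight hG (fun y => (hwZ y).le) hKQ' hST1 hDQ
    have e2 : β - 1 + 1 = β := by ring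
    rw [e2] at hDQT
    exact hDQT.of_rate_le hG.dnn (mul_nonneg hKQ' hΛ₁0) hρ₂α
  have h44 : ∀ ε, 0 < ε → ε ≤ 1 → HasMaj (bHX ε) (BlockNorm.ofBlocks (toB6 g R₀ H₀) (𝔬.blk ∘ Prod.fst))
      (familyOp (fun q : P × P => Dd U q.1 ∘ₗ (𝔬.GG U ∘ₗ Dds U q.2))) (fun (a b : g.Site) => K44 ε * Real.exp (-(ρ₄ * g.dist a b))) := by
    intro ε h0 h1
    have hI0 : 0 ≤ κS * CR₁ * tI ε * c := mul_nonneg (mul_nonneg (mul_nonneg hκS0 hCR₁) (htI ε h0)) hc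
    have h := GG_input44Family_of_members hG hrow hc hI0 hB₃ (hBr ε h0)
      (add_nonneg (hBi ε h0 h1) (mul_nonneg (mul_nonneg (mul_nonneg hκS0 htD) (htI ε h0)) hc))
      (add_nonneg (hBd ε h0 h1) (mul_nonneg (mul_nonneg (mul_nonneg hκS0 htD) (htV ε h0)) hc)) (mul_nonneg hKQ0 hΛ₁0) hσ hρ₄0 le_rfl hρ₂ρ hρ₂₃
      (fun μ => h2A μ ε h0) wZ hwZ hL.q1 hL.c1_1 hI (fun μ => hrgdd μ ε h0) (fun q => hGop q ε h0 h1) (fun ν => hGDv ν ε h0 h1) hGQ44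
    refine h.mono fun a b => mul_le_mul_of_nonneg_right ?_ (Real.exp_nonneg _)
    have e1 : (bHW ε).κ * (Bd ε + κS * tD * tV ε * c) * Br ε * c ≤ κS * (Bd ε + κS * tD * tV ε * c) * Br ε * c :=
      mul_le_mul_of_nonneg_right (mul_le_mul_of_nonneg_right (mul_le_mul_of_nonneg_right (hκW ε)
        (add_nonneg (hBd ε h0 h1) (mul_nonneg (mul_nonneg (mul_nonneg hκS0 htD) (htV ε h0)) hc))) (hBr ε h0)) hc
    linarith only [e1, hK44le ε h0 h1]
  have h45 : ∀ ε β, 0 < ε → ε ≤ 1 → 0 ≤ β → β < 1 →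
      HasMaj (bHX (β + ε)) (BlockNorm.ofBlocks (toB6 g R₀ H₀) (𝔭.blkPX ∘ Prod.fst))
      (sliceProbe (𝔭.ΦX U β) ∘ₗ familyOp (fun q : P × P => Dd U q.1 ∘ₗ (𝔬.GG U ∘ₗ Dds U q.2)))
      (fun (a b : g.Site) => K45 ε β * g.len a ^ (-β) * Real.exp (-(ρ₄ * g.dist a b))) := by
    intro ε β h0 h1 hb0 hb1
    have hε' : 0 < β + ε := by linarith
    have hI0 : 0 ≤ κS * CR₁ * tI (β + ε) * c := mul_nonneg (mul_nonneg (mul_nonneg hκS0 hCR₁) (htI (β + ε) hε')) hc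
    have hKQ' : 0 ≤ Bq β + κS * tH β * tR * c := add_nonneg (hBq β hb0 hb1) (mul_nonneg (mul_nonneg (mul_nonneg hκS0 (htH β hb0 hb1)) htR) hc)
    have h := GG_input45Family_of_members hG 𝔭 hrow hc hI0 hB₃ (hBr (β + ε) hε')
      (add_nonneg (hBi2 ε β h0 h1 hb0 hb1) (mul_nonneg (mul_nonneg (mul_nonneg hκS0 (htH β hb0 hb1)) (htI (β + ε) hε')) hc))
      (add_nonneg (hBd2 ε β h0 h1 hb0 hb1) (mul_nonneg (mul_nonneg (mul_nonneg hκS0 (htH β hb0 hb1)) (htV (β + ε) hε')) hc))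
      (mul_nonneg hKQ' hΛ₁0) hσ hρ₄0 le_rfl hρ₂ρ hρ₂₃
      (fun μ => h2A μ (β + ε) hε') wZ hwZ hL.q1 hL.c1_1 hI (fun μ => hrgdd μ (β + ε) hε') (fun q => hGop45 q ε β h0 h1 hb0 hb1)
      (fun ν => hGD45 ν ε β h0 h1 hb0 hb1) (fun ν => hGQ45 ν β hb0 hb1)
    refine h.mono fun a b => mul_le_mul_of_nonneg_right (mul_le_mul_of_nonneg_right ?_ (Real.rpow_nonneg (hlen a) _)) (Real.exp_nonneg _)
    have e1 : (bHW (β + ε)).κ * (Bd2 ε β + κS * tH β * tV (β + ε) * c) * Br (β + ε) * c ≤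
        κS * (Bd2 ε β + κS * tH β * tV (β + ε) * c) * Br (β + ε) * c :=
      mul_le_mul_of_nonneg_right (mul_le_mul_of_nonneg_right (mul_le_mul_of_nonneg_right (hκW (β + ε))
        (add_nonneg (hBd2 ε β h0 h1 hb0 hb1) (mul_nonneg (mul_nonneg (mul_nonneg hκS0 (htH β hb0 hb1)) (htV (β + ε) hε')) hc)))
        (hBr (β + ε) hε')) hc
    linarith only [e1, hK45le ε β h0 h1 hb0 hb1]
  exact ⟨h44, h45⟩

/-! ## §2 ★★★ The three blocks of a kernel family co-read by 𝔊, from the state — input letters FIELD-WISE -/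

/-- ★★★ **THEOREM 3.13 — THE SUP ENTRIES, THE L² BLOCK AND THE HÖLDER∕INPUT BLOCK OF A KERNEL FAMILY CO-READ BY 𝔊, FROM THE REGULAR STATE** (one member, one configuration;
the per-member residual of the row-21 S-leaf): `B9Thm313WholeGGBlocksRegular.GG_entries_of_stateS ∕ GG_probes_of_stateS` (by name) + `B9Thm313WholeGGBlocksEntries.GG_l2Block_of_entries` + `GG_inputs_of_stateST` (the (3.152)–(3.153) input letters `rgdd dgDvd pdgDvd` as three plain families — the record `Letters313IMBC` with its never-read right-form field `tDv` is NOT a hypothesis) +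
`ineq343_345_of_majorants_pairM`.  CONCLUSION: (i) the three sup entries of 𝔊 at (C_e, ρ′); (ii) `L2Block K (mN·m·Cev·CL²·e^{rδ}·K₆) δ U`; (iii) `B9.Ineq343_345 K (β ↦
m·CL·e^{rρ₄}·C_u β) (ε ↦ e^{rρ₄}·K₄₄ ε) ((ε,β) ↦ CL·e^{rρ₄}·K₄₅ ε β) ρ₄ U` — for ANY target constants above the displayed polynomials in the (uniform) input constants.
[cite: Balaban1985BackgroundPropagators, Thm 3.13 p.426 + Thm 3.12 pp.421–423 + (3.42)–(3.47) pp.397–398 + (3.152)–(3.153) p.426; Balaban1984PropagatorsII, (2.51)–(2.56) pp.232–233 + Lemma 2.1 (2.60)–(2.61) p.234] -/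
theorem GG_blocks_of_stateST (hG : GeoOK g) (𝔭 : HolderProbes g B X Y PX PY) (K : B9.KernelFamily g B) {𝔬 : Ops g B X Y Z W} {U : B.Cfg}
    {Dd Dds : B.Cfg → P → Module.End ℝ (X → ℝ)}
    {bHX : ℝ → BlockNorm (toB6 g R₀ H₀) (X → ℝ)} {bHW : ℝ → BlockNorm (toB6 g R₀ H₀) (W → ℝ)} {bH : BlockNorm (toB6 g R₀ H₀) (W → ℝ)}
    {Gp : B.Cfg → Module.End ℝ (W → ℝ)} {bXH : BlockNorm (toB6 g R₀ H₀) (X → ℝ)} (𝔖₂ 𝔖₁ : BlockNorm (toB6 g R₀ H₀) (X → ℝ))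
    (Rel : g.Site → g.Site → Prop) [DecidableRel Rel] (ev : g.Loc → X → ℝ) (evY : g.Loc → Y → ℝ) {m mN : ℕ}
    {r Cev CL tD tR θ₂' B₀ B₂ B₃ B₄ CR CR₁ κS Λ₁ Λh Λm Λu δ₀ δ₃ δK δP ρ ρ₁ ρ' ρ₄ α σ c δ Ce KGu K6 : ℝ}
    {tH tI tV Br Bh Bi Bq Bd BhD Bx Cu K44 : ℝ → ℝ} {Bi2 Bd2 K45 : ℝ → ℝ → ℝ}
    (hrow : RowSum (toB6 g R₀ H₀) σ c) (hc : 0 ≤ c) (htD : 0 ≤ tD) (htR : 0 ≤ tR) (htH : ∀ β, 0 ≤ β → β < 1 → 0 ≤ tH β)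
    (htI : ∀ ε, 0 < ε → 0 ≤ tI ε) (htV : ∀ ε, 0 < ε → 0 ≤ tV ε) (hθ₂' : 0 ≤ θ₂') (hB₀ : 0 ≤ B₀) (hB₂ : 0 ≤ B₂) (hB₃ : 0 ≤ B₃) (hB₄ : 0 ≤ B₄)
    (hCR : 0 ≤ CR) (hCR₁ : 0 ≤ CR₁) (hκS : 1 ≤ κS) (hBr : ∀ ε, 0 < ε → 0 ≤ Br ε)
    (hBh : ∀ β, 0 ≤ β → β < 1 → 0 ≤ Bh β) (hBi : ∀ ε, 0 < ε → ε ≤ 1 → 0 ≤ Bi ε) (hBq : ∀ β, 0 ≤ β → β < 1 → 0 ≤ Bq β)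
    (hBd : ∀ ε, 0 < ε → ε ≤ 1 → 0 ≤ Bd ε) (hBi2 : ∀ ε β, 0 < ε → ε ≤ 1 → 0 ≤ β → β < 1 → 0 ≤ Bi2 ε β)
    (hBd2 : ∀ ε β, 0 < ε → ε ≤ 1 → 0 ≤ β → β < 1 → 0 ≤ Bd2 ε β) (hBhD : ∀ β, 0 ≤ β → β < 1 → 0 ≤ BhD β)
    (hBx : ∀ β, 0 ≤ β → β < 1 → 0 ≤ Bx β)
    (hκ : bH.κ ≤ κS) (hκW : ∀ ε, (bHW ε).κ ≤ κS) (hκX : bXH.κ ≤ κS) (hκ2 : 𝔖₂.κ ≤ κS) (hκ1 : 𝔖₁.κ ≤ κS)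
    (hα0 : 0 ≤ α) (hσ : 0 ≤ σ) (hρ' : 0 < ρ') (hρ'ρ : ρ' + 3 * σ ≤ ρ) (hρ'ρ₅ : ρ' + 5 * σ ≤ ρ)
    (hρ₄0 : 0 ≤ ρ₄) (hρ₄r : ρ₄ + 3 * σ ≤ (1 - α) * ρ') (hρS : ρ ≤ δ₀) (hρ₃ : ρ ≤ δ₃) (hρ₁ : ρ₁ = ρ + σ) (hρP : ρ + 2 * σ ≤ δP)
    (hρK : ρ + 2 * σ ≤ δK) (hq₂1 : B₂ * θ₂' * c * c < 1) (hδ0 : 0 ≤ δ) (hδ1 : δ ≤ (1 - α) * ρ') (hδ2 : δ ≤ ρ')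
    (hST1 : ScaleTransfer g ρ' α Λ₁ (fun y => g.len y ^ (1 : ℝ))) (hSTh : ScaleTransfer g ρ' α Λh (fun y => g.len y ^ (1 / 2 : ℝ)))
    (hSTm : ScaleTransfer g ρ' α Λm (fun y => g.len y ^ (-1 : ℝ))) (hΛ₁0 : 0 ≤ Λ₁) (hΛ₁le : Λ₁ ≤ Λu) (hΛhle : Λh ≤ Λu)
    (hΛm0 : 0 ≤ Λm) (hΛmle : Λm ≤ Λu) (h1Λu : 1 ≤ Λu)
    -- the target constants, uniform in the leaf, and the inequalities they satisfy
    (hCe0 : 0 ≤ Ce) (hCea : const313 (κS * CR * tR * c) (κS * CR * tR * c) B₃ c ≤ Ce)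
    (hCeb : B₀ + κS * tD * tR * c + κS * B₃ * B₃ * c + κS * tD * tR * c * B₃ * c +
      (B₃ + κS * tD * tR * c) * (B₃ * (B₃ * (κS * CR * tR * c) * c) * c) * c ≤ Ce)
    (hCec : κS * CR₁ * tR * c + κS * B₃ * B₃ * c + κS * CR₁ * tR * c * (B₃ * (B₃ * (κS * CR₁ * tR * c) * c) * c) * c ≤ Ce)
    (hKGu0 : 0 ≤ KGu) (hKGle : constG46 (constKp B₂ B₄ θ₂' c) c ≤ KGu) (hK60 : 0 ≤ K6) (hK6a : Ce * Λu ≤ K6) (hK6b : KGu ≤ K6)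
    (hK6c : Real.sqrt (Fintype.card (P × P)) * (KGu * Λu) ≤ K6)
    (hCu0 : ∀ β, 0 ≤ β → β < 1 → 0 ≤ Cu β)
    (hCuL : ∀ β, 0 ≤ β → β < 1 → (Bh β + κS * tH β * tR * c) + κS * BhD β * B₃ * c + κS * tH β * tR * c * B₃ * c +
      (Bq β + κS * tH β * tR * c) * (B₃ * (B₃ * (κS * CR * tR * c) * c) * c) * c ≤ Cu β)
    (hCuR : ∀ β, 0 ≤ β → β < 1 → (Bh β + κS * tH β * tR * c) + κS * Bx β * B₃ * c +
      (Bx β + κS * tH β * tR * c) * (B₃ * (B₃ * (κS * CR₁ * tR * c) * c) * c) * c ≤ Cu β)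
    (hK440 : ∀ ε, 0 < ε → ε ≤ 1 → 0 ≤ K44 ε)
    (hK44le : ∀ ε, 0 < ε → ε ≤ 1 → (Bi ε + κS * tD * tI ε * c) + κS * (Bd ε + κS * tD * tV ε * c) * Br ε * c +
      (B₃ + κS * tD * tR * c) * Λ₁ * (B₃ * (B₃ * (κS * CR₁ * tI ε * c) * c) * c) * c ≤ K44 ε)
    (hK450 : ∀ ε β, 0 < ε → ε ≤ 1 → 0 ≤ β → β < 1 → 0 ≤ K45 ε β)
    (hK45le : ∀ ε β, 0 < ε → ε ≤ 1 → 0 ≤ β → β < 1 → (Bi2 ε β + κS * tH β * tI (β + ε) * c) +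
      κS * (Bd2 ε β + κS * tH β * tV (β + ε) * c) * Br (β + ε) * c +
      (Bq β + κS * tH β * tR * c) * Λ₁ * (B₃ * (B₃ * (κS * CR₁ * tI (β + ε) * c) * c) * c) * c ≤ K45 ε β)
    -- Theorem 3.3's members
    (he1 : HasMajorantHom (g := toB6 g R₀ H₀) 𝔬.blk 𝔬.blkY (𝔬.D U ∘ₗ 𝔬.G0 U) (fun (a b : g.Site) => B₀ * g.len a * Real.exp (-(δ₀ * g.dist a b))))
    (hH0 : Thm33G0Dir 𝔬 𝔭 Dd Dds R₀ H₀ bHX B₀ Bh Bi Bi2 δ₀ U)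
    -- the letters of record
    {wZ : g.Site → ℝ} {hwZ : ∀ y, 0 < wZ y}
    (hHH : LettersHHZ 𝔬 𝔭 R₀ H₀ hG.lenle (weightNorm (BlockNorm.ofBlocks (toB6 g R₀ H₀) 𝔬.blkZ) wZ fun y => (hwZ y).le) Bq δ₃ U)
    (hH3 : Letters313HZc 𝔬 𝔭 Gp R₀ H₀ hG wZ hwZ bH BhD Bx δ₃ bXH U)
    (hL : Letters313Zc 𝔬 Gp R₀ H₀ hG wZ hwZ B₃ δ₃ bXH U) (hLD : Letters313DZ 𝔬 R₀ H₀ hG wZ hwZ B₃ δ₃ bH U)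
    (hLDM : Letters313DMZ 𝔬 𝔭 Dd R₀ H₀ hG wZ hwZ B₃ Bq δ₃ bH U)
    (hrgdd : ∀ (μ : P) (ε : ℝ), 0 < ε → HasMaj (bHX ε) (bHW ε) (𝔬.R U ∘ₗ 𝔬.Dvstar U ∘ₗ 𝔬.G1 U ∘ₗ Dds U μ)
      (fun a b => Br ε * Real.exp (-(δ₃ * g.dist a b))))
    (hdgDvd : ∀ (ν : P) (ε : ℝ), 0 < ε → ε ≤ 1 → HasMaj (bHW ε) (BlockNorm.ofBlocks (toB6 g R₀ H₀) 𝔬.blk)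
      (Dd U ν ∘ₗ (𝔬.G0 U ∘ₗ 𝔬.Dv U)) (fun (a b : g.Site) => Bd ε * Real.exp (-(δ₃ * g.dist a b))))
    (hpdgDvd : ∀ (ν : P) (ε β : ℝ), 0 < ε → ε ≤ 1 → 0 ≤ β → β < 1 → HasMaj (bHW (β + ε)) (BlockNorm.ofBlocks (toB6 g R₀ H₀) 𝔭.blkPX)
      ((𝔭.ΦX U β ∘ₗ Dd U ν) ∘ₗ (𝔬.G0 U ∘ₗ 𝔬.Dv U))
      (fun (a b : g.Site) => Bd2 ε β * g.len a ^ (-β) * Real.exp (-(δ₃ * g.dist a b)))) (hI : Identities 𝔬 U) (h152 : Ids3152 𝔬 Gp U)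
    (hL2 : Thm33G0L2M 𝔬 Dd Dds R₀ H₀ B₂ ρ U)
    (hT : BlockBd (g := toB6 g R₀ H₀) 𝔬.blk 𝔬.blk (𝔬.Tpi U + 𝔬.T2 U)
      (fun (y y' : g.Site) => θ₂' * (g.len y)⁻¹ * (g.len y')⁻¹ * Real.exp (-(ρ * g.dist y y'))))
    {vZ : g.Site → ℝ} {hvZ : ∀ y, 0 < vZ y}
    (hLt : Letters313L2Pc 𝔬 Dd Dds R₀ H₀ B₄ ρ vZ hvZ U) (hLM : Letters313L2MZ 𝔬 Dd Dds R₀ H₀ B₄ ρ vZ hvZ U)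
    (hsym : IsTransposePair (𝔬.GG U) (𝔬.GG U)) (htr : IsTransposePair (𝔬.D U ∘ₗ 𝔬.GG U) (𝔬.GG U ∘ₗ 𝔬.Dstar U))
    -- the readings data
    (hRd₂ : ∀ a b b', Rel b b' → g.dist a b = g.dist a b')
    (hmult : ∀ y' : g.Site, (Finset.univ.filter (fun y'' => Rel y'' y')).card ≤ m)
    (hnbr : ∀ y : g.Site, (nbr g r y).card ≤ mN)
    (hCL1 : 1 ≤ CL) (hCL : ∀ a a' : g.Site, g.dist a a' ≤ r → g.len a ≤ CL * g.len a') (hCev : 0 ≤ Cev)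
    (hl0 : L2ReadsNbr (R := R₀) (H := H₀) K 0 U Rel r Cev 𝔬.blk 𝔬.blk ev (𝔬.GG U))
    (hl1 : L2ReadsNbr (R := R₀) (H := H₀) K 1 U Rel r Cev 𝔬.blkY 𝔬.blk ev (𝔬.D U ∘ₗ 𝔬.GG U))
    (hl2 : L2ReadsNbr (R := R₀) (H := H₀) K 2 U Rel r Cev 𝔬.blk 𝔬.blkY evY (𝔬.GG U ∘ₗ 𝔬.Dstar U))
    (hl3 : L2ReadsNbr (R := R₀) (H := H₀) K 3 U Rel r Cev (𝔬.blk ∘ Prod.fst) 𝔬.blk ev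
      (familyOp (fun q : P × P => Dd U q.1 ∘ₗ (𝔬.GG U ∘ₗ Dds U q.2))))
    (hl4 : L2ReadsNbr (R := R₀) (H := H₀) K 4 U Rel r Cev (𝔬.blk ∘ Prod.fst) 𝔬.blk ev
      (familyOp (fun q : P × P => (Dd U q.1 ∘ₗ Dd U q.2) ∘ₗ 𝔬.GG U)))
    (hl5 : L2ReadsNbr (R := R₀) (H := H₀) K 5 U Rel r Cev (𝔬.blk ∘ Prod.fst) 𝔬.blk ev
      (familyOp (fun q : P × P => 𝔬.GG U ∘ₗ (Dds U q.1 ∘ₗ Dds U q.2))))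
    (hH1 : H1ReadsNbr K U 𝔭 Rel r 𝔬.blk 𝔬.blkY ev evY (𝔬.D U ∘ₗ 𝔬.GG U) (𝔬.GG U ∘ₗ 𝔬.Dstar U))
    (hIn : InputReadsFam K U bHX r (𝔬.blk ∘ Prod.fst) (𝔭.blkPX ∘ Prod.fst) (fun β => sliceProbe (𝔭.ΦX U β)) ev
      (familyOp (fun q : P × P => Dd U q.1 ∘ₗ (𝔬.GG U ∘ₗ Dds U q.2))))
    -- the step fields OUT OF the state classes, T = Δ′_π + Δ⁽²⁾_π
    (hD2 : HasMaj 𝔖₂ (cNorm R₀ H₀ 𝔬.blkY hG.lenle 1) (𝔬.D U ∘ₗ 𝔬.G0 U ∘ₗ (𝔬.Tpi U + 𝔬.T2 U)) (fun a b => tD * Real.exp (-(δK * g.dist a b))))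
    (hDd2 : ∀ ν : P, HasMaj 𝔖₂ (cNorm R₀ H₀ 𝔬.blk hG.lenle 1) (Dd U ν ∘ₗ 𝔬.G0 U ∘ₗ (𝔬.Tpi U + 𝔬.T2 U))
      (fun a b => tD * Real.exp (-(δK * g.dist a b))))
    (hY2 : ∀ β : ℝ, 0 ≤ β → β < 1 → HasMaj 𝔖₂ (cNormR R₀ H₀ 𝔭.blkPY hG.lenle (β - 1))
      ((𝔭.ΦY U β ∘ₗ 𝔬.D U ∘ₗ 𝔬.G0 U) ∘ₗ (𝔬.Tpi U + 𝔬.T2 U)) (fun a b => tH β * Real.exp (-(δK * g.dist a b))))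
    (hXd2 : ∀ (ν : P) (β : ℝ), 0 ≤ β → β < 1 → HasMaj 𝔖₂ (cNormR R₀ H₀ 𝔭.blkPX hG.lenle (β - 1))
      ((𝔭.ΦX U β ∘ₗ Dd U ν ∘ₗ 𝔬.G0 U) ∘ₗ (𝔬.Tpi U + 𝔬.T2 U)) (fun a b => tH β * Real.exp (-(δK * g.dist a b))))
    (hDd1 : ∀ ν : P, HasMaj 𝔖₁ (cNormR R₀ H₀ 𝔬.blk hG.lenle 0) (Dd U ν ∘ₗ 𝔬.G0 U ∘ₗ (𝔬.Tpi U + 𝔬.T2 U))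
      (fun a b => tD * Real.exp (-(δK * g.dist a b))))
    (hX1 : ∀ β : ℝ, 0 ≤ β → β < 1 → HasMaj 𝔖₁ (cNormR R₀ H₀ 𝔭.blkPX hG.lenle (β - 1))
      ((𝔭.ΦX U β ∘ₗ 𝔬.G0 U) ∘ₗ (𝔬.Tpi U + 𝔬.T2 U)) (fun a b => tH β * Real.exp (-(δK * g.dist a b))))
    (hXd1 : ∀ (ν : P) (β : ℝ), 0 ≤ β → β < 1 → HasMaj 𝔖₁ (cNormR R₀ H₀ 𝔭.blkPX hG.lenle β)
      ((𝔭.ΦX U β ∘ₗ Dd U ν ∘ₗ 𝔬.G0 U) ∘ₗ (𝔬.Tpi U + 𝔬.T2 U)) (fun a b => tH β * Real.exp (-(δK * g.dist a b))))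
    -- the right entries of G₁ INTO the state classes
    (hG12 : HasMaj (cNorm R₀ H₀ 𝔬.blk hG.lenle 0) 𝔖₂ (𝔬.G1 U ∘ₗ LinearMap.id) (fun a b => tR * Real.exp (-(ρ₁ * g.dist a b))))
    (hGD2 : HasMaj (cNorm R₀ H₀ 𝔬.blkW hG.lenle 1) 𝔖₂ (𝔬.G1 U ∘ₗ 𝔬.Dv U) (fun a b => tR * Real.exp (-(ρ₁ * g.dist a b))))
    (hGQ2 : HasMaj (weightNorm (BlockNorm.ofBlocks (toB6 g R₀ H₀) 𝔬.blkZ) wZ fun y => (hwZ y).le) 𝔖₂ (𝔬.G1 U ∘ₗ 𝔬.Qstar U)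
      (fun a b => tR * Real.exp (-(ρ₁ * g.dist a b))))
    (hGDs1 : HasMaj (cNormR R₀ H₀ 𝔬.blkY hG.lenle 0) 𝔖₁ (𝔬.G1 U ∘ₗ 𝔬.Dstar U) (fun a b => tR * Real.exp (-(ρ₁ * g.dist a b))))
    (hGQ1 : HasMaj (weightNorm (BlockNorm.ofBlocks (toB6 g R₀ H₀) 𝔬.blkZ) (fun y => g.len y * wZ y) fun y => (wZlen_pos hG hwZ y).le) 𝔖₁
      (𝔬.G1 U ∘ₗ 𝔬.Qstar U) (fun a b => tR * Real.exp (-(ρ₁ * g.dist a b))))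
    (hGI1 : ∀ (μ : P) (ε : ℝ), 0 < ε → HasMaj (bHX ε) 𝔖₁ (𝔬.G1 U ∘ₗ Dds U μ) (fun a b => tI ε * Real.exp (-(ρ₁ * g.dist a b))))
    (hGV1 : ∀ ε : ℝ, 0 < ε → HasMaj (bHW ε) 𝔖₁ (𝔬.G1 U ∘ₗ 𝔬.Dv U) (fun a b => tV ε * Real.exp (-(ρ₁ * g.dist a b))))
    -- the sup readings of the states
    (hRd2 : HasMaj 𝔖₂ (cNormR R₀ H₀ 𝔬.blk hG.lenle (-2)) LinearMap.id (fun a b => CR * Real.exp (-(δP * g.dist a b))))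
    (hRd1 : HasMaj 𝔖₁ (cNormR R₀ H₀ 𝔬.blk hG.lenle (-1)) LinearMap.id (fun a b => CR₁ * Real.exp (-(δP * g.dist a b)))) :
    (HasMajorant (g := toB6 g R₀ H₀) 𝔬.blk (𝔬.GG U) (fun a b => Ce * g.len a ^ 2 * Real.exp (-(ρ' * g.dist a b))) ∧
      HasMajorantHom (g := toB6 g R₀ H₀) 𝔬.blk 𝔬.blkY (𝔬.D U ∘ₗ 𝔬.GG U) (fun (a b : g.Site) => Ce * g.len a * Real.exp (-(ρ' * g.dist a b))) ∧
      HasMajorantHom (g := toB6 g R₀ H₀) 𝔬.blkY 𝔬.blk (𝔬.GG U ∘ₗ 𝔬.Dstar U) (fun (a b : g.Site) => Ce * g.len a * Real.exp (-(ρ' * g.dist a b)))) ∧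
    L2Block K (mN * m * Cev * CL ^ 2 * Real.exp (r * δ) * K6) δ U ∧
    B9.Ineq343_345 K (fun β => m * CL * Real.exp (r * ρ₄) * Cu β) (fun ε => Real.exp (r * ρ₄) * K44 ε)
      (fun ε β => CL * Real.exp (r * ρ₄) * K45 ε β) ρ₄ U := by
  have h1α : (1 - α) * ρ' ≤ ρ' := by nlinarith
  have hρ₄ρ' : ρ₄ ≤ ρ' := by linarith
  obtain ⟨hm0, hm1, hm2⟩ := GG_entries_of_stateS hG 𝔖₂ 𝔖₁ hrow hc htD htR hB₀ hB₃ hCR hCR₁ hκS hκ hκX hκ2 hκ1 hσ hρ' hρ'ρ hρS hρ₃ hρ₁ hρP hρK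
    hCea hCeb hCec he1 hL hLD hI h152 hD2 hG12 hGD2 hGQ2 hGDs1 hGQ1 hRd2 hRd1
  obtain ⟨hL43, hR43⟩ := GG_probes_of_stateS hG 𝔭 𝔖₂ 𝔖₁ hrow hc htR htH hB₃ hCR hCR₁ hκS hBh hBq hBhD hBx hκ hκX hκ2 hκ1 hσ hρ' hρ'ρ hρ₄ρ'
    hρS hρ₃ hρ₁ hρP hρK hCu0 hCuL hCuR hH0 hHH hH3 hL hLD hI h152 hY2 hX1 hG12 hGD2 hGQ2 hGDs1 hGQ1 hRd2 hRd1
  obtain ⟨h44, h45⟩ := GG_inputs_of_stateST hG 𝔭 𝔖₂ 𝔖₁ hrow hc htD htR htH htI htV hB₃ hCR₁ hκS hBr hBi hBq hBd hBi2 hBd2 hκW hκ2 hκ1 hα0 hσ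
    hρ' hρ'ρ hρ₄0 hρ₄r hρS hρ₃ hρ₁ hρP hρK hST1 hΛ₁0 hK44le hK45le hH0 hL hLDM hrgdd hdgDvd hpdgDvd hI hDd2 hXd2 hDd1 hXd1 hGQ2 hGI1 hGV1 hRd1
  -- (5) the L² block at the entry line
  have hl2B := GG_l2Block_of_entries hG Rel ev evY hrow hc hθ₂' hB₂ hB₄ hσ hρ' hρ'ρ₅ hq₂1 hδ0 hδ1 hδ2 hST1 hSTh hSTm hΛ₁0 hΛ₁le hΛhle
    hΛm0 hΛmle h1Λu hCe0 hKGu0 hKGle hK60 hK6a hK6b hK6c hm0 hm1 hm2 hI hL2 hT hLt hLM hsym htr hRd₂ hmult hnbr hCL1 hCL hCev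
    hl0 hl1 hl2 hl3 hl4 hl5
  have hHo := ineq343_345_of_majorants_pairM (R := R₀) (H := H₀) hG 𝔭 bHX hRd₂ hmult hCL1 hCL hCu0 hK440 hK450 hρ₄0 hL43 hR43 h44 h45 hH1 hIn
  exact ⟨⟨hm0, hm1, hm2⟩, hl2B, hHo⟩

end OneMember

end

end Literature.MathematicalPhysics.QuantumFieldTheory.Balaban1983to89.B9Thm313WholeGGBlocksRegularT
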